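import Summits.CriticalPhenomena.PercolationContinuityZ3.Theorems.PercNonProliferationSubpolynomialBlockingStubCritAnnulusCrossingPos
import Summits.CriticalPhenomena.PercolationContinuityZ3.Theorems.PercNonProliferationSubpolynomialBlockingStubAnnulusCrossingRenorm
import HarnessLib

/-!
# Crux `PercNonProliferation.SubpolynomialBlocking` (stmt-CriticalPhenomena-4446) — negative lane:
# the critical annulus IS crossed with probability `≥ c` (every `d ≥ 2`), unconditionally

Lead c3 (prover-line-stmt-CriticalPhenomena-4446-c3-0). Assembly of the two landed stubs
`stub_annulusCrossing_renorm` (p117117: `a_{20n}(p) ≤ (100^d a_n(p))²` for every `d`, `p`, `n ≥ 1`, where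
`a_n(p) = P_p(annulusCrossing d n)` = "`Λ_n` is joined to `∂ⁱⁿΛ_{2n}` inside `Λ_{2n}`") and `stub_critAnnulusCrossing_pos`
(p116959: the renormalisation inequality forces `a_n(p_c) ≥ c > 0` uniformly — otherwise crossings would decay
super-exponentially slightly ABOVE `p_c` by continuity, contradicting `θ > 0` there). The registered signature proved
verbatim is `critAnnulusCrossing_pos`; lands `--supports 4446`.

## Results (all at `p_c(ℤ^d)`, `d ≥ 2`)

* `critAnnulusCrossing_pos` : `∃ c > 0, ∀ n ≥ 1, c ≤ P_{p_c}(annulusCrossing d n)` — the "in print" half of Disproof §7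
  (critical crossing probability bounded away from zero), now in the tree for every dimension.
* `blockProb_le_one_sub` : `∃ c > 0, ∀ n ≥ 1, u_n(d, p_c) ≤ 1 - c` — the crux's blocking probability is bounded AWAY FROM ONE
  (the Negative lane had only `u_n < 1`, `Negative.blockProb_lt_one`). Together with the crux's claim this brackets `u_n` on `ℤ³`
  between `n^{-s}` (claimed) / `e^{-o(n²)}` (proved, p111169) and `1 - c` (here).
* `real_siteToBoundary_ge` : `∃ c > 0, ∀ n ≥ 1, c / (2n+1)^d ≤ P_{p_c}(0 ↔ ∂Λ_n)` — a polynomial LOWER bound on the critical one-arm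
  probability in every dimension (union bound `Negative.real_annulusCrossing_le_card_mul` over the `|Λ_n| = (2n+1)^d` starting points,
  and `Λ_n ↔ ∂ⁱⁿΛ_{2n}` forces an arm of length `n` from some point of `Λ_n`).
-/

noncomputable section

namespace Summit.CriticalPhenomena.PercolationContinuityZ3.Theorems.SubpolynomialBlocking

open MeasureTheory Filter Topology
open Literature.Probability.Percolation Literature.Probability.LatticeModels
open Literature.Barriers.CriticalPhenomena
open Summit.CriticalPhenomena.PercolationContinuityZ3.Theorems.SubpolynomialBlocking.Negative

/-- **The critical annulus is crossed with probability bounded away from zero** (registered on crux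
stmt-CriticalPhenomena-4446 as `critAnnulusCrossing_pos`): for every `d ≥ 2` there is `c > 0` with
`c ≤ P_{p_c(ℤ^d)}(Λ_n ↔ ∂ⁱⁿΛ_{2n} inside Λ_{2n})` for all `n ≥ 1`. Assembly of `stub_critAnnulusCrossing_pos` (p116959) with its
hypothesis `stub_annulusCrossing_renorm` (p117117). Folklore / in print as the negation of the finite-size criterion for
exponential decay (e.g. Duminil-Copin–Kozma–Tassion 2020, §1.1); the tree had no form of it. -/
theorem critAnnulusCrossing_pos : ∀ d : ℕ, 2 ≤ d → ∃ c : ℝ, 0 < c ∧ ∀ n : ℕ, 1 ≤ n → c ≤ (bondPercolation (zdGraph d) (criticalProbI d)).real (Literature.Barriers.CriticalPhenomena.annulusCrossing d n) :=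
  stub_critAnnulusCrossing_pos stub_annulusCrossing_renorm

/-- **The critical blocking probability is bounded away from one**: for `d ≥ 2` there is `c > 0` with
`u_n(d, p_c) = P_{p_c}((annulusCrossing d n)ᶜ) ≤ 1 - c` for all `n ≥ 1` (`blockProb = 1 - P(cross)`, `Negative.blockProb_eq`). On `ℤ³` this
is the upper side of the bracket `n^{-s} ≤? u_n ≤ 1 - c` in which the crux lives. -/
theorem blockProb_le_one_sub :
    ∀ d : ℕ, 2 ≤ d → ∃ c : ℝ, 0 < c ∧ ∀ n : ℕ, 1 ≤ n → blockProb d (criticalProbI d) n ≤ 1 - c := by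
  intro d hd
  obtain ⟨c, hc, h⟩ := critAnnulusCrossing_pos d hd
  refine ⟨c, hc, fun n hn => ?_⟩
  rw [blockProb_eq]
  linarith [h n hn]

/-- **Polynomial lower bound on the critical one-arm probability, every `d ≥ 2`**: there is `c > 0` with
`c / (2n+1)^d ≤ P_{p_c}(0 ↔ ∂Λ_n)` for all `n ≥ 1`. Proof: `c ≤ P(annulusCrossing d n) ≤ |Λ_n| · P_{p_c}(0 ↔ ∂Λ_n)`
(`Negative.real_annulusCrossing_le_card_mul`: a crossing from `Λ_n` contains an arm `x ↔ x + ∂Λ_n` from some `x ∈ Λ_n`,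
union bound and translation invariance), `|Λ_n| = (2n+1)^d` (`card_box`). -/
theorem real_siteToBoundary_ge :
    ∀ d : ℕ, 2 ≤ d → ∃ c : ℝ, 0 < c ∧ ∀ n : ℕ, 1 ≤ n →
      c / (2 * (n : ℝ) + 1) ^ d ≤ (bondPercolation (zdGraph d) (criticalProbI d)).real (siteToBoundary d n) := by
  intro d hd
  obtain ⟨c, hc, h⟩ := critAnnulusCrossing_pos d hd
  refine ⟨c, hc, fun n hn => ?_⟩
  have hcard : ((box d n).card : ℝ) = (2 * (n : ℝ) + 1) ^ d := by
    rw [card_box]; push_cast; ring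
  have hpos : (0 : ℝ) < (2 * (n : ℝ) + 1) ^ d := by positivity
  have key := (h n hn).trans (real_annulusCrossing_le_card_mul d (criticalProbI d) n)
  rw [hcard] at key
  rw [div_le_iff₀ hpos]
  linarith [mul_comm ((2 * (n : ℝ) + 1) ^ d) ((bondPercolation (zdGraph d) (criticalProbI d)).real (siteToBoundary d n))]

end Summit.CriticalPhenomena.PercolationContinuityZ3.Theorems.SubpolynomialBlocking

end
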